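import Literature.Geometry.Riemannian.MeanConvexLevelSetFlow
import Literature.Geometry.Riemannian.LevelSetMeanCurvature
import Literature.Geometry.Lorentzian.LeviCivitaProofs
import Literature.Geometry.Riemannian.ColdingMinicozziEntropyValues
import Literature.Geometry.Riemannian.ColdingMinicozziEntropyInvariance
import Literature.Geometry.Riemannian.ShrinkingSphereEntropy
import HarnessLib

/-!
# Homothetically shrinking round spheres are a classical mean curvature flow

Topic `Literature/Geometry/Riemannian`. The first inhabitant of the tree's classical mean
curvature flows `Literature.Geometry.Riemannian.IsClassicalMCF` (`MeanConvexLevelSetFlow.lean`,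
the barrier class of Hershkovits–White's weak set flows): for `n ≥ 1` and an extinction time
`T`, the family of round spheres of `ℝⁿ⁺¹`

  `F t y = R(t) y`, `y ∈ 𝕊ⁿ`, `R(t) = √(2 n (T - t))`, with the outward unit normal `ν t y = y`,

is a classical mean curvature flow of smooth closed embedded hypersurfaces on every
`[a, b] ⊆ (-∞, T)` for the Euclidean metric (`isClassicalMCF_shrinkingSphere`): `∂F/∂t = R'(t) y =
-(n / R(t)) y = -H ν`, the round sphere of radius `R` having mean curvature `H = n / R` for the
outward normal in the tree's convention (`Hypersurface.lean`: `H = tr K`, `K(v, w) = ⟪D_v ν, df w⟫`;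
computed here from the level-set formula `H = ‖∇F‖⁻¹ ∑ᵢ Hess F(vᵢ, vᵢ)` of
`LevelSetMeanCurvature.lean` for `F = ‖x‖²`, whose gradient is `2x` and Hessian `2⟪·, ·⟫`).
This is the model singularity of the flow — G. Huisken, *Flow by mean curvature of convex surfaces
into spheres*, J. Differential Geom. 20 (1984), §1 ("if `M₀` is a sphere of radius `R₀` then `M_t`
is a sphere of radius `R(t) = √(R₀² - 2nt)`", extinct at `T = R₀²/(2n)`); T. H. Colding,
W. P. Minicozzi II, *Generic mean curvature flow I*, Ann. of Math. 175 (2012), §1 and p. 758 (the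
self-shrinking sphere `𝕊ⁿ(√(2n))` is the time `-1` slice of the flow extinct at `T = 0`:
`range_shrinkingSphereFlow_sub_one`, `= shrinkingCylinder n n` of
`ColdingMinicozziEntropyValues.lean`) — and it is the barrier used in every avoidance argument
(e.g. White 2000, §2): by the definition of weak set flows, a weak set flow disjoint from a round
sphere stays disjoint from the shrinking spheres (`IsWeakSetFlowIn.disjoint_shrinkingSphere`).
Everything is PROVED; no named facts.

## Contents

* `fderiv_normSq_apply`, `gradient_normSq`, `iteratedFDeriv_two_normSq`, `unitGradient_normSq` —
  calculus of `F(x) = ‖x‖²`: `dF_x v = 2⟪x, v⟫`, `∇F = 2x`, `Hess F(a, b) = 2⟪a, b⟫`,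
  `∇F/‖∇F‖ = x/‖x‖`;
* `shrinkingSphereRadius n T t = √(2n(T - t))` and its derivative `-(n / R)`
  (`hasDerivAt_shrinkingSphereRadius`); `shrinkingSphereFlow`, `shrinkingSphereNormal`;
* `meanCurvature_smul_coe_sphere` — **the round sphere of radius `R > 0` has mean curvature
  `n / R`** for the outward normal (tree convention); primed versions with the smoothness /
  immersion witnesses discharged, `meanCurvature_coe_sphere` (`H(𝕊ⁿ) = n`);
* `isClassicalMCF_shrinkingSphere` — the theorem of the title;
* `range_shrinkingSphereFlow` (`= sphere 0 (R t)`), `range_shrinkingSphereFlow_sub_one`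
  (`= shrinkingCylinder n n` at `t = T - 1`), `shrinkingSphereRadius_self` (extinction at `T`);
* `IsWeakSetFlowIn.disjoint_shrinkingSphere` — spheres as barriers for weak set flows;
* the same about an arbitrary centre `c` (level function `‖x - c‖²`): `shrinkingSphereFlowAt`,
  `meanCurvature_const_add_smul_coe_sphere`, `isClassicalMCF_shrinkingSphereAt`,
  `IsWeakSetFlowIn.disjoint_shrinkingSphereAt`, and the radius form of the avoidance principle
  `IsWeakSetFlowIn.disjoint_sphere_sqrt`: if `K a` misses `sphere c r₀` then `K (a + s)` misses
  `sphere c √(r₀² - 2ns)` for `0 ≤ s < r₀²/(2n)` (White 2000, §2);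
* `gaussianArea_shrinkingSphereFlow` — **Huisken's density of the shrinking sphere**:
  `F_{0,T-t}(M_t) = λ(𝕊ⁿ) = Λ_n` for all `t < T` (equality case of the monotonicity formula:
  dilation invariance `gaussianArea_smul` + Stone's value), `= λ(M_t)`
  (`gaussianEntropy_shrinkingSphereFlow`, `gaussianArea_shrinkingSphereFlow_eq_gaussianEntropy`).

## References

* [Huisken1984] G. Huisken, J. Differential Geom. 20 (1984) 237–266, §1.
* [ColdingMinicozzi2012] T. H. Colding, W. P. Minicozzi II, Ann. of Math. 175 (2012), §1, p. 758.
* [White2000] B. White, J. Amer. Math. Soc. 13 (2000), §2 (avoidance of classical flows).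
* [HershkovitsWhite2019] O. Hershkovits, B. White, Comm. Pure Appl. Math. 73 (2020), App. Def. 19.
-/

noncomputable section

open Bundle Set Function Metric Module Filter
open scoped Manifold ContDiff Topology RealInnerProductSpace Gradient
-- Mathlib's scoped instance `Fact (finrank ℝ (EuclideanSpace ℝ (Fin n)) = n)`, feeding the
-- `[Fact (finrank ℝ V = n + 1)]` hypotheses of the sphere API
open scoped EuclideanSpace

namespace Literature.Geometry.Riemannian

open Lorentzian Lorentzian.PseudoRiemannianMetric

set_option hygiene false in
/-- `𝕍` : the ambient space `ℝⁿ⁺¹ = EuclideanSpace ℝ (Fin (n + 1))` (local notation). -/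
local notation "𝕍" => EuclideanSpace ℝ (Fin (n + 1))

set_option hygiene false in
/-- `𝕊` : the unit sphere `𝕊ⁿ ⊂ ℝⁿ⁺¹` (local notation). -/
local notation "𝕊" => sphere (0 : EuclideanSpace ℝ (Fin (n + 1))) 1

set_option hygiene false in
/-- `dι[y]`: the differential of the inclusion `ι : 𝕊ⁿ ↪ ℝⁿ⁺¹` at `y`, as a map into `ℝⁿ⁺¹`
(Mathlib's `mvfderiv`, definitionally `mfderiv`). Local notation. -/
local notation "dι[" y "]" =>
  mvfderiv (𝓡 n) (Subtype.val : sphere (0 : EuclideanSpace ℝ (Fin (n + 1))) 1 →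
    EuclideanSpace ℝ (Fin (n + 1))) y


/-! ### Calculus of `‖x‖²` -/

section NormSq

variable {W : Type*} [NormedAddCommGroup W] [InnerProductSpace ℝ W]

/-- `d(‖·‖²)_x v = 2⟪x, v⟫`. [folklore] -/
theorem fderiv_normSq_apply (x v : W) : fderiv ℝ (fun x : W ↦ ‖x‖ ^ 2) x v = 2 * ⟪x, v⟫ := by
  rw [(hasStrictFDerivAt_norm_sq x).hasFDerivAt.fderiv]
  simp [innerSL_apply_apply]

variable [FiniteDimensional ℝ W]

/-- `∇(‖·‖²)(x) = 2x`. [folklore] -/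
theorem gradient_normSq (x : W) : ∇ (fun x : W ↦ ‖x‖ ^ 2) x = (2 : ℝ) • x := by
  refine ext_inner_right ℝ fun v ↦ ?_
  rw [inner_gradient_eq_fderiv, fderiv_normSq_apply, inner_smul_left]
  simp

/-- `Hess(‖·‖²)_x(a, b) = 2⟪a, b⟫`. [folklore] -/
theorem iteratedFDeriv_two_normSq (x a b : W) :
    iteratedFDeriv ℝ 2 (fun x : W ↦ ‖x‖ ^ 2) x ![a, b] = 2 * ⟪a, b⟫ := by
  rw [← inner_fderiv_gradient (contDiff_norm_sq ℝ)]
  have hg : ∇ (fun x : W ↦ ‖x‖ ^ 2) = fun x ↦ (2 : ℝ) • x := funext gradient_normSq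
  have h2 : HasFDerivAt (fun x : W ↦ (2 : ℝ) • x) ((2 : ℝ) • ContinuousLinearMap.id ℝ W) x :=
    (hasFDerivAt_id x).const_smul (2 : ℝ)
  rw [hg, h2.fderiv]
  simp [inner_smul_left]

/-- `∇F/‖∇F‖ = x/‖x‖` for `F = ‖·‖²` and `x ≠ 0`. [folklore] -/
theorem unitGradient_normSq {x : W} (hx : x ≠ 0) :
    unitGradient (fun x : W ↦ ‖x‖ ^ 2) x = ‖x‖⁻¹ • x := by
  rw [unitGradient, gradient_normSq, norm_smul, Real.norm_two, smul_smul]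
  congr 1
  have hx' : ‖x‖ ≠ 0 := norm_ne_zero_iff.2 hx
  field_simp

end NormSq

/-! ### The shrinking sphere: radius, flow map, normal -/

section Flow

variable {n : ℕ}

/-- The radius `R(t) = √(2 n (T - t))` of the shrinking sphere with extinction time `T`
(Huisken 1984, §1: `R(t) = √(R₀² - 2nt)`, `T = R₀²/(2n)`). [cite: Huisken1984, §1] -/
def shrinkingSphereRadius (n : ℕ) (T t : ℝ) : ℝ := Real.sqrt (2 * n * (T - t))

/-- `R(t) > 0` before the extinction time (`n ≥ 1`). [cite: Huisken1984, §1] -/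
theorem shrinkingSphereRadius_pos (hn : 1 ≤ n) {T t : ℝ} (ht : t < T) :
    0 < shrinkingSphereRadius n T t := by
  unfold shrinkingSphereRadius
  have : (0 : ℝ) < n := by exact_mod_cast hn
  exact Real.sqrt_pos.2 (by nlinarith)

/-- Extinction: `R(T) = 0`. [cite: Huisken1984, §1] -/
@[simp] theorem shrinkingSphereRadius_self (n : ℕ) (T : ℝ) : shrinkingSphereRadius n T T = 0 := by
  simp [shrinkingSphereRadius]

/-- `R(T - 1) = √(2n)`: one unit of time before extinction the radius is that of the
self-shrinking sphere `𝕊ⁿ(√(2n))`. [cite: ColdingMinicozzi2012, p. 758] -/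
theorem shrinkingSphereRadius_sub_one (n : ℕ) (T : ℝ) :
    shrinkingSphereRadius n T (T - 1) = Real.sqrt (2 * n) := by
  simp [shrinkingSphereRadius]

/-- `R(t)² = 2 n (T - t)` for `t ≤ T`. [cite: Huisken1984, §1] -/
theorem shrinkingSphereRadius_sq {T t : ℝ} (ht : t ≤ T) :
    shrinkingSphereRadius n T t ^ 2 = 2 * n * (T - t) := by
  unfold shrinkingSphereRadius
  rw [Real.sq_sqrt]
  have : (0 : ℝ) ≤ n := Nat.cast_nonneg n
  nlinarith

/-- **`R'(t) = -n / R(t)`** (so that `R R' = -n`: the ODE of the shrinking sphere).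
[cite: Huisken1984, §1] -/
theorem hasDerivAt_shrinkingSphereRadius (hn : 1 ≤ n) {T t : ℝ} (ht : t < T) :
    HasDerivAt (shrinkingSphereRadius n T) (-(n / shrinkingSphereRadius n T t)) t := by
  have hR := shrinkingSphereRadius_pos hn ht
  have hpos : 0 < 2 * n * (T - t) := by
    have h := shrinkingSphereRadius_sq ht.le (n := n)
    nlinarith [hR]
  have hlin : HasDerivAt (fun s : ℝ ↦ 2 * n * (T - s)) (2 * n * (0 - 1)) t :=
    ((hasDerivAt_const t T).sub (hasDerivAt_id t)).const_mul (2 * (n : ℝ))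
  have hsqrt := (Real.hasDerivAt_sqrt hpos.ne').comp t hlin
  refine hsqrt.congr_deriv ?_
  change 1 / (2 * Real.sqrt (2 * n * (T - t))) * (2 * n * (0 - 1)) =
    -(n / Real.sqrt (2 * n * (T - t)))
  have hs : Real.sqrt (2 * n * (T - t)) ≠ 0 := by
    change shrinkingSphereRadius n T t ≠ 0
    exact hR.ne'
  field_simp
  ring

/-- `R` is smooth before the extinction time. [cite: Huisken1984, §1] -/
theorem contDiffAt_shrinkingSphereRadius (hn : 1 ≤ n) {T t : ℝ} (ht : t < T) :
    ContDiffAt ℝ ∞ (shrinkingSphereRadius n T) t := by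
  have hpos : 2 * n * (T - t) ≠ 0 := by
    have h := shrinkingSphereRadius_sq ht.le (n := n)
    have hR := shrinkingSphereRadius_pos hn ht
    nlinarith [hR]
  unfold shrinkingSphereRadius
  exact (Real.contDiffAt_sqrt hpos).comp t (by fun_prop)

/-- **The shrinking sphere flow** `F t y = R(t) y` on the unit sphere `𝕊ⁿ ⊂ ℝⁿ⁺¹`
(Huisken 1984, §1). [cite: Huisken1984, §1] -/
def shrinkingSphereFlow (n : ℕ) (T : ℝ) (t : ℝ) (y : 𝕊) :
    𝕍 :=
  shrinkingSphereRadius n T t • (y : 𝕍)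

/-- **The outward unit normal** `ν t y = y` along the shrinking sphere flow. [cite: Huisken1984, §1] -/
def shrinkingSphereNormal (n : ℕ) (T : ℝ) (t : ℝ) :
    NormalField (𝓡 (n + 1)) (shrinkingSphereFlow n T t) :=
  fun y ↦ (y : 𝕍)

/-- Unfolding of the flow map. [folklore] -/
@[simp] theorem shrinkingSphereFlow_apply (n : ℕ) (T t : ℝ)
    (y : 𝕊) :
    shrinkingSphereFlow n T t y = shrinkingSphereRadius n T t • (y : 𝕍) :=
  rfl

/-- Unfolding of the normal field. [folklore] -/
@[simp] theorem shrinkingSphereNormal_apply (n : ℕ) (T t : ℝ)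
    (y : 𝕊) :
    shrinkingSphereNormal n T t y = (y : 𝕍) :=
  rfl

/-- **The time slices are round spheres**: `range (F t) = sphere 0 (R t)` for `t < T`.
[cite: Huisken1984, §1] -/
theorem range_shrinkingSphereFlow (hn : 1 ≤ n) {T t : ℝ} (ht : t < T) :
    range (shrinkingSphereFlow n T t) =
      sphere (0 : 𝕍) (shrinkingSphereRadius n T t) := by
  have hR := shrinkingSphereRadius_pos hn ht
  ext x
  simp only [mem_range, shrinkingSphereFlow_apply, mem_sphere_zero_iff_norm]
  constructor
  · rintro ⟨y, rfl⟩
    rw [norm_smul, Real.norm_of_nonneg hR.le, norm_eq_of_mem_sphere y, mul_one]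
  · intro hx
    have hx0 : x ≠ 0 := fun h ↦ by
      rw [h, norm_zero] at hx
      exact hR.ne' hx.symm
    refine ⟨⟨‖x‖⁻¹ • x, ?_⟩, ?_⟩
    · rw [mem_sphere_zero_iff_norm, norm_smul, norm_inv, norm_norm,
        inv_mul_cancel₀ (norm_ne_zero_iff.2 hx0)]
    · simp only
      rw [hx, smul_smul, mul_inv_cancel₀ hR.ne', one_smul]

/-- **The self-shrinking sphere is a time slice**: one unit of time before extinction the flow is
the sphere `𝕊ⁿ(√(2n)) = shrinkingCylinder n n` of Colding–Minicozzi (the generalised cylinder with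
`k = n`). [cite: ColdingMinicozzi2012, p. 758] -/
theorem range_shrinkingSphereFlow_sub_one (hn : 1 ≤ n) (T : ℝ) :
    range (shrinkingSphereFlow n T (T - 1)) = shrinkingCylinder n n := by
  rw [range_shrinkingSphereFlow hn (by linarith), shrinkingSphereRadius_sub_one,
    shrinkingCylinder_self]

/-- The flow map is injective before extinction. [folklore] -/
theorem injective_shrinkingSphereFlow (hn : 1 ≤ n) {T t : ℝ} (ht : t < T) :
    Injective (shrinkingSphereFlow n T t) := fun _ _ h ↦
  Subtype.ext (smul_right_injective _ (shrinkingSphereRadius_pos hn ht).ne' h)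

end Flow

/-! ### The mean curvature of a round sphere and the flow equation -/

section MCF

variable {n : ℕ}

/-- The Euclidean metric of `ℝⁿ⁺¹` has its Levi-Civita connection (the tree's general existence
theorem `PseudoRiemannianMetric.hasLeviCivita`), as an instance for the statements below.
[folklore] -/
instance euclideanMetric_hasLeviCivita_euclideanSpace (n : ℕ) :
    (euclideanMetric (𝕍)).HasLeviCivita :=
  (euclideanMetric (𝕍)).hasLeviCivita

/-- **`d(c ι)_y = c dι_y`** as maps into `ℝⁿ⁺¹` (Mathlib's `const_smul_mfderiv`, restated with
`mvfderiv`). [folklore] -/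
theorem mvfderiv_smul_coe_sphere (c : ℝ) (y : 𝕊) :
    mvfderiv (𝓡 n) (fun y : 𝕊 ↦ c • (y : 𝕍)) y = c • dι[y] := by
  have hd : MDifferentiableAt (𝓡 n) (𝓡 (n + 1)) (Subtype.val : 𝕊 → 𝕍) y :=
    ((contMDiff_coe_sphere (n := n)) y).mdifferentiableAt one_ne_zero
  refine ContinuousLinearMap.ext fun v ↦ ?_
  change (mfderiv (𝓡 n) (𝓡 (n + 1)) (c • (Subtype.val : 𝕊 → 𝕍)) y v : 𝕍) =
    c • (mfderiv (𝓡 n) (𝓡 (n + 1)) (Subtype.val : 𝕊 → 𝕍) y v : 𝕍)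
  rw [const_smul_mfderiv hd c]
  rfl

/-- `dι_y` is injective (Mathlib's `mfderiv_coe_sphere_injective`, restated with `mvfderiv`).
[folklore] -/
theorem mvfderiv_coe_sphere_ne_zero (y : 𝕊) {v : TangentSpace (𝓡 n) y} (hv : v ≠ 0) :
    dι[y] v ≠ 0 := fun h ↦
  hv (mfderiv_coe_sphere_injective (n := n) y (by rw [map_zero]; exact h))

/-- `y ↦ c • y` on the unit sphere is `C^m` for every `m`. [folklore] -/
theorem contMDiff_smul_coe_sphere (c : ℝ) {m : ℕ∞ω} :
    ContMDiff (𝓡 n) (𝓡 (n + 1)) m (fun y : 𝕊 ↦ c • (y : 𝕍)) := by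
  have hc' : ContMDiff (𝓡 n) 𝓘(ℝ, ℝ) m (fun _ : 𝕊 ↦ c) := contMDiff_const
  exact hc'.smul (contMDiff_coe_sphere (n := n))

/-- **`y ↦ c • y` on the unit sphere is a spacelike immersion for the Euclidean metric**
(`c ≠ 0`): `⟪d(cι) v, d(cι) v⟫ = c² ⟪dι v, dι v⟫ > 0` for `v ≠ 0`. [folklore] -/
theorem isSpacelikeImmersion_smul_coe_sphere {c : ℝ} (hc : c ≠ 0) :
    (euclideanMetric 𝕍).IsSpacelikeImmersion (𝓡 n) (fun y : 𝕊 ↦ c • (y : 𝕍)) := by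
  refine ⟨contMDiff_smul_coe_sphere c, fun y v hv ↦ ?_⟩
  rw [inducedBilin_apply, euclideanMetric_apply]
  change (0 : ℝ) < ⟪mvfderiv (𝓡 n) (fun y : 𝕊 ↦ c • (y : 𝕍)) y v,
    mvfderiv (𝓡 n) (fun y : 𝕊 ↦ c • (y : 𝕍)) y v⟫
  rw [mvfderiv_smul_coe_sphere]
  change (0 : ℝ) < ⟪c • dι[y] v, c • dι[y] v⟫
  rw [real_inner_smul_left, real_inner_smul_right, ← mul_assoc]
  exact mul_pos (mul_self_pos.2 hc) (real_inner_self_pos.2 (mvfderiv_coe_sphere_ne_zero y hv))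

/-- **The position vector is a unit normal of sign `+1` along `y ↦ c • y`** (Euclidean metric):
`⟪y, c dι_y v⟫ = 0` (tangent vectors are orthogonal to the position vector,
`inner_coe_mvfderiv_coe_sphere`) and `⟪y, y⟫ = 1`. [folklore] -/
theorem isUnitNormal_smul_coe_sphere (c : ℝ) :
    (euclideanMetric 𝕍).IsUnitNormal (𝓡 n) (fun y : 𝕊 ↦ c • (y : 𝕍)) (fun y ↦ ((y : 𝕊) : 𝕍)) 1 := by
  refine ⟨fun y v ↦ ?_, fun y ↦ ?_⟩
  · rw [euclideanMetric_apply]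
    change ⟪(y : 𝕍), mvfderiv (𝓡 n) (fun y : 𝕊 ↦ c • (y : 𝕍)) y v⟫ = 0
    rw [mvfderiv_smul_coe_sphere]
    change ⟪(y : 𝕍), c • dι[y] v⟫ = 0
    rw [real_inner_smul_right, inner_coe_mvfderiv_coe_sphere, mul_zero]
  · rw [euclideanMetric_apply]
    change ⟪(y : 𝕍), (y : 𝕍)⟫ = 1
    rw [real_inner_self_eq_norm_sq, norm_eq_of_mem_sphere, one_pow]

/-- **The round sphere of radius `c > 0` has mean curvature `n / c`** for the outward unit normal,
in the tree's convention `H = tr_{f^*δ} K`, `K(v, w) = ⟪D_v ν, df w⟫` (so `H > 0` and spheres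
shrink under `∂F/∂t = -H ν`). From the level-set formula
`meanCurvature_unitGradient_eq_sum` with `F = ‖x‖²`: `∇F = 2x`, `‖∇F‖ = 2c` on the sphere,
`Hess F(vᵢ, vᵢ) = 2` for an orthonormal tangent frame, so `H = (2c)⁻¹ · 2n`.
[cite: Huisken1984, §1] -/
theorem meanCurvature_smul_coe_sphere {c : ℝ} (hc : 0 < c)
    (hpb : contMDiff_pullbackBilin (𝓡 (n + 1)) 𝕍 (𝓡 n) 𝕊 ∞)
    (hf : (euclideanMetric 𝕍).IsSpacelikeImmersion (𝓡 n) (fun y : 𝕊 ↦ c • (y : 𝕍))) (y : 𝕊) :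
    (euclideanMetric 𝕍).meanCurvature (fun y : 𝕊 ↦ c • (y : 𝕍)) hpb hf (fun z ↦ ((z : 𝕊) : 𝕍)) y =
      n / c := by
  have hFl : ContDiff ℝ ∞ (fun x : 𝕍 ↦ ‖x‖ ^ 2) := contDiff_norm_sq ℝ
  have hy : (𝓡 n).IsInteriorPoint y := BoundarylessManifold.isInteriorPoint
  have hy0 : (y : 𝕍) ≠ 0 := ne_zero_of_mem_unit_sphere y
  have hcy : c • (y : 𝕍) ≠ 0 := smul_ne_zero hc.ne' hy0
  have hx : ∇ (fun x : 𝕍 ↦ ‖x‖ ^ 2) (c • (y : 𝕍)) ≠ 0 := by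
    rw [gradient_normSq]
    exact smul_ne_zero two_ne_zero hcy
  have hdF : ∀ w : TangentSpace (𝓡 n) y, fderiv ℝ (fun x : 𝕍 ↦ ‖x‖ ^ 2) (c • (y : 𝕍))
      (mfderiv (𝓡 n) 𝓘(ℝ, 𝕍) (fun y : 𝕊 ↦ c • (y : 𝕍)) y w) = 0 := by
    intro w
    change fderiv ℝ (fun x : 𝕍 ↦ ‖x‖ ^ 2) (c • (y : 𝕍))
      (mvfderiv (𝓡 n) (fun y : 𝕊 ↦ c • (y : 𝕍)) y w) = 0
    rw [fderiv_normSq_apply, mvfderiv_smul_coe_sphere]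
    change 2 * ⟪c • (y : 𝕍), c • dι[y] w⟫ = 0
    rw [real_inner_smul_left, real_inner_smul_right, inner_coe_mvfderiv_coe_sphere]
    ring
  have hν : (fun z : 𝕊 ↦ (unitGradient (fun x : 𝕍 ↦ ‖x‖ ^ 2) (c • (z : 𝕍)) : 𝕍)) =
      fun z ↦ ((z : 𝕊) : 𝕍) := by
    funext z
    have hz0 : (z : 𝕍) ≠ 0 := ne_zero_of_mem_unit_sphere z
    rw [unitGradient_normSq (smul_ne_zero hc.ne' hz0), norm_smul, Real.norm_of_nonneg hc.le,
      norm_eq_of_mem_sphere, mul_one, smul_smul, inv_mul_cancel₀ hc.ne', one_smul]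
  obtain ⟨b, hbo, -, hH⟩ :=
    meanCurvature_unitGradient_eq_sum (W := 𝕍) (I' := 𝓡 n) hFl hpb hf hy hx hdF
      (finrank_euclideanSpace_fin (𝕜 := ℝ) (n := n))
  rw [hν] at hH
  rw [hH, gradient_normSq, norm_smul, norm_smul, Real.norm_two, Real.norm_of_nonneg hc.le,
    norm_eq_of_mem_sphere, mul_one]
  simp_rw [iteratedFDeriv_two_normSq, real_inner_self_eq_norm_sq, hbo.1, one_pow, mul_one,
    Finset.sum_const, Finset.card_univ, Fintype.card_fin, nsmul_eq_mul]
  field_simp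

/-- **The mean curvature of the shrinking sphere at time `t < T` is `n / R(t)`.**
[cite: Huisken1984, §1] -/
theorem meanCurvature_shrinkingSphereFlow (hn : 1 ≤ n) {T t : ℝ} (ht : t < T)
    (hpb : contMDiff_pullbackBilin (𝓡 (n + 1)) 𝕍 (𝓡 n) 𝕊 ∞)
    (hf : (euclideanMetric 𝕍).IsSpacelikeImmersion (𝓡 n) (shrinkingSphereFlow n T t)) (y : 𝕊) :
    (euclideanMetric 𝕍).meanCurvature (shrinkingSphereFlow n T t) hpb hf (shrinkingSphereNormal n T t)
      y = n / shrinkingSphereRadius n T t :=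
  meanCurvature_smul_coe_sphere (shrinkingSphereRadius_pos hn ht) hpb hf y

/-- **`H = n / c` for the round sphere of radius `c`, with the witnesses discharged**: the mean
curvature of `y ↦ c • y` for the tree's canonical smoothness witness
`contMDiff_pullbackBilin_holds` and the immersion proof `isSpacelikeImmersion_smul_coe_sphere`.
[cite: Huisken1984, §1] -/
theorem meanCurvature_smul_coe_sphere' {c : ℝ} (hc : 0 < c) (y : 𝕊) :
    (euclideanMetric 𝕍).meanCurvature (fun y : 𝕊 ↦ c • (y : 𝕍)) contMDiff_pullbackBilin_holds
      (isSpacelikeImmersion_smul_coe_sphere hc.ne') (fun z ↦ ((z : 𝕊) : 𝕍)) y = n / c :=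
  meanCurvature_smul_coe_sphere hc _ _ y

/-- **The mean curvature of the unit sphere `𝕊ⁿ ⊂ ℝⁿ⁺¹` is `n`** for the outward normal (tree
convention; witnesses discharged). [cite: Huisken1984, §1] -/
theorem meanCurvature_coe_sphere (y : 𝕊) :
    (euclideanMetric 𝕍).meanCurvature (fun y : 𝕊 ↦ (1 : ℝ) • (y : 𝕍)) contMDiff_pullbackBilin_holds
      (isSpacelikeImmersion_smul_coe_sphere one_ne_zero) (fun z ↦ ((z : 𝕊) : 𝕍)) y = n := by
  rw [meanCurvature_smul_coe_sphere' one_pos, div_one]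

/-- The normal field `y ↦ (F t y, y)` is smooth into the tangent bundle of `ℝⁿ⁺¹`: it is the
smooth ambient field `x ↦ R⁻¹ x` composed with the flow map. [folklore] -/
theorem contMDiff_shrinkingSphereNormal (hn : 1 ≤ n) {T t : ℝ} (ht : t < T) :
    ContMDiff (𝓡 n) (𝓡 (n + 1)).tangent ∞ fun y : 𝕊 ↦
      (TotalSpace.mk' 𝕍 (shrinkingSphereFlow n T t y) (shrinkingSphereNormal n T t y) :
        TangentBundle (𝓡 (n + 1)) 𝕍) := by
  have hR := (shrinkingSphereRadius_pos hn ht).ne'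
  have hsec : ∀ x : 𝕍, ContMDiffAt 𝓘(ℝ, 𝕍) 𝓘(ℝ, 𝕍).tangent ∞
      (fun x : 𝕍 ↦ (TotalSpace.mk' 𝕍 x ((shrinkingSphereRadius n T t)⁻¹ • x) :
        TangentBundle 𝓘(ℝ, 𝕍) 𝕍)) x := fun x ↦
    contMDiffAt_section_of_contDiffAt (contDiff_id.const_smul _).contDiffAt
  have hF : ContMDiff (𝓡 n) (𝓡 (n + 1)) ∞ (shrinkingSphereFlow n T t) :=
    contMDiff_smul_coe_sphere _
  have hcomp : ContMDiff (𝓡 n) (𝓡 (n + 1)).tangent ∞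
      ((fun x : 𝕍 ↦ (TotalSpace.mk' 𝕍 x ((shrinkingSphereRadius n T t)⁻¹ • x) :
        TangentBundle 𝓘(ℝ, 𝕍) 𝕍)) ∘ shrinkingSphereFlow n T t) :=
    fun y ↦ (hsec _).comp y (hF y)
  refine hcomp.congr fun y ↦ ?_
  simp only [Function.comp_apply, shrinkingSphereFlow_apply, shrinkingSphereNormal_apply,
    inv_smul_smul₀ hR]

/-- **The velocity of the shrinking sphere**: `∂/∂t (R(t) y) = R'(t) y = -(n / R(t)) y`, as a
manifold derivative. [cite: Huisken1984, §1] -/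
theorem hasMFDerivAt_shrinkingSphereFlow (hn : 1 ≤ n) {T t : ℝ} (ht : t < T) (y : 𝕊) :
    HasMFDerivAt 𝓘(ℝ, ℝ) (𝓡 (n + 1)) (fun s ↦ shrinkingSphereFlow n T s y) t
      (ContinuousLinearMap.smulRight (1 : ℝ →L[ℝ] ℝ)
        ((-(n / shrinkingSphereRadius n T t)) • (y : 𝕍))) :=
  ((hasDerivAt_shrinkingSphereRadius hn ht).smul_const (y : 𝕍)).hasFDerivAt.hasMFDerivAt

/-- **Homothetically shrinking round spheres are a classical mean curvature flow** (for the
Euclidean metric of `ℝⁿ⁺¹`, `n ≥ 1`): on every `[a, b]` with `b < T`, the family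
`F t y = √(2n(T - t)) y` of embeddings of `𝕊ⁿ` with the outward unit normal `ν t y = y`
satisfies all clauses of `IsClassicalMCF` — compact parameter manifold, joint smoothness on
`(-∞, T) × 𝕊ⁿ`, each `F t` an injective (spacelike) immersion, `ν t` a smooth unit normal, and
the flow equation `∂F/∂t = R'(t) y = -(n/R(t)) y = -H ν`. Huisken 1984, §1; the barrier of
White's avoidance principle. [cite: Huisken1984, §1] -/
theorem isClassicalMCF_shrinkingSphere (hn : 1 ≤ n) (T : ℝ) {a b : ℝ} (hb : b < T) :
    IsClassicalMCF (euclideanMetric 𝕍) (shrinkingSphereFlow n T) (shrinkingSphereNormal n T)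
      a b where
  compactSpace := inferInstance
  contMDiffOn := by
    refine ⟨Iio T, isOpen_Iio, fun t ht ↦ lt_of_le_of_lt ht.2 hb, ?_⟩
    have hRd : ContDiffOn ℝ ∞ (shrinkingSphereRadius n T) (Iio T) := fun t ht ↦
      (contDiffAt_shrinkingSphereRadius hn ht).contDiffWithinAt
    have hR : ContMDiffOn 𝓘(ℝ, ℝ) 𝓘(ℝ, ℝ) ∞ (shrinkingSphereRadius n T) (Iio T) := hRd.contMDiffOn
    have h1 : ContMDiffOn (𝓘(ℝ, ℝ).prod (𝓡 n)) 𝓘(ℝ, ℝ) ∞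
        (fun p : ℝ × 𝕊 ↦ shrinkingSphereRadius n T p.1) (Iio T ×ˢ univ) :=
      hR.comp contMDiffOn_fst fun p hp ↦ hp.1
    have h2 : ContMDiffOn (𝓘(ℝ, ℝ).prod (𝓡 n)) (𝓡 (n + 1)) ∞
        (fun p : ℝ × 𝕊 ↦ ((p.2 : 𝕊) : 𝕍)) (Iio T ×ˢ univ) :=
      ((contMDiff_coe_sphere (n := n)).comp contMDiff_snd).contMDiffOn
    exact h1.smul h2
  isSpacelikeImmersion t ht :=
    isSpacelikeImmersion_smul_coe_sphere (shrinkingSphereRadius_pos hn (ht.2.trans_lt hb)).ne'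
  injective t ht := injective_shrinkingSphereFlow hn (ht.2.trans_lt hb)
  isUnitNormal t _ := isUnitNormal_smul_coe_sphere _
  contMDiff_normal t ht := contMDiff_shrinkingSphereNormal hn (ht.2.trans_lt hb)
  velocity_eq t ht y := by
    have htT : t < T := ht.2.trans_lt hb
    rw [(hasMFDerivAt_shrinkingSphereFlow hn htT y).mfderiv, meanCurvature_shrinkingSphereFlow hn htT]
    change (ContinuousLinearMap.smulRight (1 : ℝ →L[ℝ] ℝ)
      ((-(n / shrinkingSphereRadius n T t)) • (y : 𝕍))) (1 : ℝ) =
        -((n : ℝ) / shrinkingSphereRadius n T t) • (y : 𝕍)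
    simp

/-! ### Round spheres as barriers for weak set flows -/

/-- **Shrinking spheres are barriers** (the avoidance principle, by definition of weak set flows,
Hershkovits–White Def. 19): if a weak set flow `K` in `W ⊆ ℝⁿ⁺¹` on `I ⊇ [a, b]`, `b < T`, is
disjoint from the round sphere of radius `R(a) = √(2n(T - a))` at time `a`, and the shrinking
spheres stay in `W`, then `K t` is disjoint from the sphere of radius `R(t)` for all `t ∈ [a, b]`.
[cite: HershkovitsWhite2019, Appendix Def. 19] [cite: White2000, §2] -/
theorem IsWeakSetFlowIn.disjoint_shrinkingSphere (hn : 1 ≤ n) {W : Set 𝕍} {I : Set ℝ}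
    {K : ℝ → Set 𝕍} (hK : IsWeakSetFlowIn (euclideanMetric 𝕍) W I K) {T a b : ℝ} (hab : a ≤ b)
    (hb : b < T) (hI : Icc a b ⊆ I)
    (hW : ∀ t ∈ Icc a b, sphere (0 : 𝕍) (shrinkingSphereRadius n T t) ⊆ W)
    (ha : Disjoint (sphere (0 : 𝕍) (shrinkingSphereRadius n T a)) (K a)) {t : ℝ}
    (ht : t ∈ Icc a b) :
    Disjoint (sphere (0 : 𝕍) (shrinkingSphereRadius n T t)) (K t) := by
  have hr : ∀ s ∈ Icc a b, range (shrinkingSphereFlow n T s) =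
      sphere (0 : 𝕍) (shrinkingSphereRadius n T s) :=
    fun s hs ↦ range_shrinkingSphereFlow hn (hs.2.trans_lt hb)
  rw [← hr t ht]
  refine hK.avoidance hab hI (isClassicalMCF_shrinkingSphere hn T hb) (fun s hs ↦ ?_) ?_ ht
  · rw [hr s hs]
    exact hW s hs
  · rw [hr a ⟨le_rfl, hab⟩]
    exact ha

end MCF

/-! ### Spheres about an arbitrary centre

The same flow translated to a centre `c ∈ ℝⁿ⁺¹` — the form in which round spheres serve as
barriers around arbitrary points (White 2000, §2). The level function is now `F(x) = ‖x - c‖²`. -/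

section NormSqSub

variable {W : Type*} [NormedAddCommGroup W] [InnerProductSpace ℝ W]

/-- `‖· - c‖²` is smooth. [folklore] -/
theorem contDiff_normSqSub (c : W) : ContDiff ℝ ∞ (fun x : W ↦ ‖x - c‖ ^ 2) :=
  (contDiff_norm_sq ℝ).comp (contDiff_id.sub contDiff_const)

/-- `d(‖· - c‖²)_x v = 2⟪x - c, v⟫`. [folklore] -/
theorem fderiv_normSqSub_apply (c x v : W) :
    fderiv ℝ (fun x : W ↦ ‖x - c‖ ^ 2) x v = 2 * ⟪x - c, v⟫ := by
  have h : HasFDerivAt (fun x : W ↦ ‖x - c‖ ^ 2)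
      (2 • (innerSL ℝ (x - c)).comp (ContinuousLinearMap.id ℝ W)) x :=
    (hasFDerivAt_sub_const c).norm_sq
  rw [h.fderiv]
  simp [innerSL_apply_apply, inner_sub_left]

variable [FiniteDimensional ℝ W]

/-- `∇(‖· - c‖²)(x) = 2(x - c)`. [folklore] -/
theorem gradient_normSqSub (c x : W) : ∇ (fun x : W ↦ ‖x - c‖ ^ 2) x = (2 : ℝ) • (x - c) := by
  refine ext_inner_right ℝ fun v ↦ ?_
  rw [inner_gradient_eq_fderiv, fderiv_normSqSub_apply, inner_smul_left]
  simp

/-- `Hess(‖· - c‖²)_x(a, b) = 2⟪a, b⟫`. [folklore] -/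
theorem iteratedFDeriv_two_normSqSub (c x a b : W) :
    iteratedFDeriv ℝ 2 (fun x : W ↦ ‖x - c‖ ^ 2) x ![a, b] = 2 * ⟪a, b⟫ := by
  rw [← inner_fderiv_gradient (contDiff_normSqSub c)]
  have hg : ∇ (fun x : W ↦ ‖x - c‖ ^ 2) = fun x ↦ (2 : ℝ) • (x - c) :=
    funext (gradient_normSqSub c)
  have h2 : HasFDerivAt (fun x : W ↦ (2 : ℝ) • (x - c)) ((2 : ℝ) • ContinuousLinearMap.id ℝ W) x :=
    ((hasFDerivAt_id x).sub_const c).const_smul (2 : ℝ)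
  rw [hg, h2.fderiv]
  simp [inner_smul_left]

/-- `∇F/‖∇F‖ = (x - c)/‖x - c‖` for `F = ‖· - c‖²` and `x ≠ c`. [folklore] -/
theorem unitGradient_normSqSub {c x : W} (hx : x - c ≠ 0) :
    unitGradient (fun x : W ↦ ‖x - c‖ ^ 2) x = ‖x - c‖⁻¹ • (x - c) := by
  rw [unitGradient, gradient_normSqSub, norm_smul, Real.norm_two, smul_smul]
  congr 1
  have hx' : ‖x - c‖ ≠ 0 := norm_ne_zero_iff.2 hx
  field_simp

end NormSqSub

section Centred

variable {n : ℕ}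

/-- **The shrinking sphere flow about the centre `c`**: `F t y = c + R(t) y` on `𝕊ⁿ`.
[cite: Huisken1984, §1] -/
def shrinkingSphereFlowAt (n : ℕ) (c : 𝕍) (T : ℝ) (t : ℝ) (y : 𝕊) : 𝕍 :=
  c + shrinkingSphereRadius n T t • (y : 𝕍)

/-- The outward unit normal `ν t y = y` along the centred flow. [cite: Huisken1984, §1] -/
def shrinkingSphereNormalAt (n : ℕ) (c : 𝕍) (T : ℝ) (t : ℝ) :
    NormalField (𝓡 (n + 1)) (shrinkingSphereFlowAt n c T t) :=
  fun y ↦ (y : 𝕍)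

/-- Unfolding of the centred flow map. [folklore] -/
@[simp] theorem shrinkingSphereFlowAt_apply (n : ℕ) (c : 𝕍) (T t : ℝ) (y : 𝕊) :
    shrinkingSphereFlowAt n c T t y = c + shrinkingSphereRadius n T t • (y : 𝕍) :=
  rfl

/-- Unfolding of the centred normal field. [folklore] -/
@[simp] theorem shrinkingSphereNormalAt_apply (n : ℕ) (c : 𝕍) (T t : ℝ) (y : 𝕊) :
    shrinkingSphereNormalAt n c T t y = (y : 𝕍) :=
  rfl

/-- **The time slices are round spheres about `c`**: `range (F t) = sphere c (R t)`, `t < T`.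
[cite: Huisken1984, §1] -/
theorem range_shrinkingSphereFlowAt (hn : 1 ≤ n) (c : 𝕍) {T t : ℝ} (ht : t < T) :
    range (shrinkingSphereFlowAt n c T t) = sphere c (shrinkingSphereRadius n T t) := by
  have h : shrinkingSphereFlowAt n c T t = (fun x : 𝕍 ↦ c + x) ∘ shrinkingSphereFlow n T t := rfl
  rw [h, Set.range_comp, range_shrinkingSphereFlow hn ht, Set.image_add_left]
  ext x
  simp only [mem_preimage, mem_sphere, dist_eq_norm, sub_zero, neg_add_eq_sub]

/-- The centred flow map is injective before extinction. [folklore] -/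
theorem injective_shrinkingSphereFlowAt (hn : 1 ≤ n) (c : 𝕍) {T t : ℝ} (ht : t < T) :
    Injective (shrinkingSphereFlowAt n c T t) :=
  (add_right_injective c).comp (injective_shrinkingSphereFlow hn ht)

/-- `d(c + d ι)_y = d dι_y`. [folklore] -/
theorem mvfderiv_const_add_smul_coe_sphere (c : 𝕍) (d : ℝ) (y : 𝕊) :
    mvfderiv (𝓡 n) (fun y : 𝕊 ↦ c + d • (y : 𝕍)) y = d • dι[y] := by
  have h1 : MDifferentiableAt (𝓡 n) (𝓡 (n + 1)) (fun _ : 𝕊 ↦ c) y := mdifferentiableAt_const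
  have h2 : MDifferentiableAt (𝓡 n) (𝓡 (n + 1)) (fun y : 𝕊 ↦ d • (y : 𝕍)) y :=
    (contMDiff_smul_coe_sphere (m := 1) d y).mdifferentiableAt one_ne_zero
  have h := mvfderiv_add h1 h2
  rw [mvfderiv_const, zero_add, mvfderiv_smul_coe_sphere] at h
  exact h

/-- `y ↦ c + d • y` on the unit sphere is `C^m` for every `m`. [folklore] -/
theorem contMDiff_const_add_smul_coe_sphere (c : 𝕍) (d : ℝ) {m : ℕ∞ω} :
    ContMDiff (𝓡 n) (𝓡 (n + 1)) m (fun y : 𝕊 ↦ c + d • (y : 𝕍)) :=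
  contMDiff_const.add (contMDiff_smul_coe_sphere d)

/-- **`y ↦ c + d • y` is a spacelike immersion** for the Euclidean metric (`d ≠ 0`). [folklore] -/
theorem isSpacelikeImmersion_const_add_smul_coe_sphere (c : 𝕍) {d : ℝ} (hd : d ≠ 0) :
    (euclideanMetric 𝕍).IsSpacelikeImmersion (𝓡 n) (fun y : 𝕊 ↦ c + d • (y : 𝕍)) := by
  refine ⟨contMDiff_const_add_smul_coe_sphere c d, fun y v hv ↦ ?_⟩
  rw [inducedBilin_apply, euclideanMetric_apply]
  change (0 : ℝ) < ⟪mvfderiv (𝓡 n) (fun y : 𝕊 ↦ c + d • (y : 𝕍)) y v,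
    mvfderiv (𝓡 n) (fun y : 𝕊 ↦ c + d • (y : 𝕍)) y v⟫
  rw [mvfderiv_const_add_smul_coe_sphere]
  change (0 : ℝ) < ⟪d • dι[y] v, d • dι[y] v⟫
  rw [real_inner_smul_left, real_inner_smul_right, ← mul_assoc]
  exact mul_pos (mul_self_pos.2 hd) (real_inner_self_pos.2 (mvfderiv_coe_sphere_ne_zero y hv))

/-- The position vector (relative to the centre) is a unit normal of sign `+1` along
`y ↦ c + d • y`. [folklore] -/
theorem isUnitNormal_const_add_smul_coe_sphere (c : 𝕍) (d : ℝ) :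
    (euclideanMetric 𝕍).IsUnitNormal (𝓡 n) (fun y : 𝕊 ↦ c + d • (y : 𝕍))
      (fun y ↦ ((y : 𝕊) : 𝕍)) 1 := by
  refine ⟨fun y v ↦ ?_, fun y ↦ ?_⟩
  · rw [euclideanMetric_apply]
    change ⟪(y : 𝕍), mvfderiv (𝓡 n) (fun y : 𝕊 ↦ c + d • (y : 𝕍)) y v⟫ = 0
    rw [mvfderiv_const_add_smul_coe_sphere]
    change ⟪(y : 𝕍), d • dι[y] v⟫ = 0
    rw [real_inner_smul_right, inner_coe_mvfderiv_coe_sphere, mul_zero]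
  · rw [euclideanMetric_apply]
    change ⟪(y : 𝕍), (y : 𝕍)⟫ = 1
    rw [real_inner_self_eq_norm_sq, norm_eq_of_mem_sphere, one_pow]

/-- **The round sphere of radius `d > 0` about `c` has mean curvature `n / d`** for the outward
unit normal (tree convention), from the level-set formula with `F = ‖x - c‖²`.
[cite: Huisken1984, §1] -/
theorem meanCurvature_const_add_smul_coe_sphere (c : 𝕍) {d : ℝ} (hd : 0 < d)
    (hpb : contMDiff_pullbackBilin (𝓡 (n + 1)) 𝕍 (𝓡 n) 𝕊 ∞)
    (hf : (euclideanMetric 𝕍).IsSpacelikeImmersion (𝓡 n) (fun y : 𝕊 ↦ c + d • (y : 𝕍))) (y : 𝕊) :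
    (euclideanMetric 𝕍).meanCurvature (fun y : 𝕊 ↦ c + d • (y : 𝕍)) hpb hf (fun z ↦ ((z : 𝕊) : 𝕍))
      y = n / d := by
  have hFl : ContDiff ℝ ∞ (fun x : 𝕍 ↦ ‖x - c‖ ^ 2) := contDiff_normSqSub c
  have hy : (𝓡 n).IsInteriorPoint y := BoundarylessManifold.isInteriorPoint
  have hy0 : (y : 𝕍) ≠ 0 := ne_zero_of_mem_unit_sphere y
  have hxc : c + d • (y : 𝕍) - c = d • (y : 𝕍) := add_sub_cancel_left c _
  have hx : ∇ (fun x : 𝕍 ↦ ‖x - c‖ ^ 2) (c + d • (y : 𝕍)) ≠ 0 := by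
    rw [gradient_normSqSub, hxc]
    exact smul_ne_zero two_ne_zero (smul_ne_zero hd.ne' hy0)
  have hdF : ∀ w : TangentSpace (𝓡 n) y, fderiv ℝ (fun x : 𝕍 ↦ ‖x - c‖ ^ 2) (c + d • (y : 𝕍))
      (mfderiv (𝓡 n) 𝓘(ℝ, 𝕍) (fun y : 𝕊 ↦ c + d • (y : 𝕍)) y w) = 0 := by
    intro w
    change fderiv ℝ (fun x : 𝕍 ↦ ‖x - c‖ ^ 2) (c + d • (y : 𝕍))
      (mvfderiv (𝓡 n) (fun y : 𝕊 ↦ c + d • (y : 𝕍)) y w) = 0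
    rw [fderiv_normSqSub_apply, mvfderiv_const_add_smul_coe_sphere, hxc]
    change 2 * ⟪d • (y : 𝕍), d • dι[y] w⟫ = 0
    rw [real_inner_smul_left, real_inner_smul_right, inner_coe_mvfderiv_coe_sphere]
    ring
  have hν : (fun z : 𝕊 ↦ (unitGradient (fun x : 𝕍 ↦ ‖x - c‖ ^ 2) (c + d • (z : 𝕍)) : 𝕍)) =
      fun z ↦ ((z : 𝕊) : 𝕍) := by
    funext z
    have hz0 : (z : 𝕍) ≠ 0 := ne_zero_of_mem_unit_sphere z
    have hzc : c + d • (z : 𝕍) - c = d • (z : 𝕍) := add_sub_cancel_left c _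
    have hne : c + d • (z : 𝕍) - c ≠ 0 := by
      rw [hzc]
      exact smul_ne_zero hd.ne' hz0
    rw [unitGradient_normSqSub hne, hzc, norm_smul, Real.norm_of_nonneg hd.le,
      norm_eq_of_mem_sphere, mul_one, smul_smul, inv_mul_cancel₀ hd.ne', one_smul]
  obtain ⟨b, hbo, -, hH⟩ :=
    meanCurvature_unitGradient_eq_sum (W := 𝕍) (I' := 𝓡 n) hFl hpb hf hy hx hdF
      (finrank_euclideanSpace_fin (𝕜 := ℝ) (n := n))
  rw [hν] at hH
  rw [hH, gradient_normSqSub, hxc, norm_smul, norm_smul, Real.norm_two, Real.norm_of_nonneg hd.le,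
    norm_eq_of_mem_sphere, mul_one]
  simp_rw [iteratedFDeriv_two_normSqSub, real_inner_self_eq_norm_sq, hbo.1, one_pow, mul_one,
    Finset.sum_const, Finset.card_univ, Fintype.card_fin, nsmul_eq_mul]
  field_simp

/-- The mean curvature of the centred shrinking sphere at time `t < T` is `n / R(t)`.
[cite: Huisken1984, §1] -/
theorem meanCurvature_shrinkingSphereFlowAt (hn : 1 ≤ n) (c : 𝕍) {T t : ℝ} (ht : t < T)
    (hpb : contMDiff_pullbackBilin (𝓡 (n + 1)) 𝕍 (𝓡 n) 𝕊 ∞)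
    (hf : (euclideanMetric 𝕍).IsSpacelikeImmersion (𝓡 n) (shrinkingSphereFlowAt n c T t)) (y : 𝕊) :
    (euclideanMetric 𝕍).meanCurvature (shrinkingSphereFlowAt n c T t) hpb hf
      (shrinkingSphereNormalAt n c T t) y = n / shrinkingSphereRadius n T t :=
  meanCurvature_const_add_smul_coe_sphere c (shrinkingSphereRadius_pos hn ht) hpb hf y

/-- **`H = n / d` for the round sphere of radius `d` about `c`, witnesses discharged.**
[cite: Huisken1984, §1] -/
theorem meanCurvature_const_add_smul_coe_sphere' (c : 𝕍) {d : ℝ} (hd : 0 < d) (y : 𝕊) :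
    (euclideanMetric 𝕍).meanCurvature (fun y : 𝕊 ↦ c + d • (y : 𝕍)) contMDiff_pullbackBilin_holds
      (isSpacelikeImmersion_const_add_smul_coe_sphere c hd.ne') (fun z ↦ ((z : 𝕊) : 𝕍)) y = n / d :=
  meanCurvature_const_add_smul_coe_sphere c hd _ _ y

/-- The centred normal field is smooth into the tangent bundle (the ambient field
`x ↦ R⁻¹ (x - c)` composed with the flow map). [folklore] -/
theorem contMDiff_shrinkingSphereNormalAt (hn : 1 ≤ n) (c : 𝕍) {T t : ℝ} (ht : t < T) :
    ContMDiff (𝓡 n) (𝓡 (n + 1)).tangent ∞ fun y : 𝕊 ↦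
      (TotalSpace.mk' 𝕍 (shrinkingSphereFlowAt n c T t y) (shrinkingSphereNormalAt n c T t y) :
        TangentBundle (𝓡 (n + 1)) 𝕍) := by
  have hR := (shrinkingSphereRadius_pos hn ht).ne'
  have hsec : ∀ x : 𝕍, ContMDiffAt 𝓘(ℝ, 𝕍) 𝓘(ℝ, 𝕍).tangent ∞
      (fun x : 𝕍 ↦ (TotalSpace.mk' 𝕍 x ((shrinkingSphereRadius n T t)⁻¹ • (x - c)) :
        TangentBundle 𝓘(ℝ, 𝕍) 𝕍)) x := fun x ↦
    contMDiffAt_section_of_contDiffAt ((contDiff_id.sub contDiff_const).const_smul _).contDiffAt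
  have hF : ContMDiff (𝓡 n) (𝓡 (n + 1)) ∞ (shrinkingSphereFlowAt n c T t) :=
    contMDiff_const_add_smul_coe_sphere c _
  have hcomp : ContMDiff (𝓡 n) (𝓡 (n + 1)).tangent ∞
      ((fun x : 𝕍 ↦ (TotalSpace.mk' 𝕍 x ((shrinkingSphereRadius n T t)⁻¹ • (x - c)) :
        TangentBundle 𝓘(ℝ, 𝕍) 𝕍)) ∘ shrinkingSphereFlowAt n c T t) :=
    fun y ↦ (hsec _).comp y (hF y)
  refine hcomp.congr fun y ↦ ?_
  simp only [Function.comp_apply, shrinkingSphereFlowAt_apply, shrinkingSphereNormalAt_apply,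
    add_sub_cancel_left, inv_smul_smul₀ hR]

/-- The velocity of the centred shrinking sphere: `∂/∂t (c + R(t) y) = -(n / R(t)) y`.
[cite: Huisken1984, §1] -/
theorem hasMFDerivAt_shrinkingSphereFlowAt (hn : 1 ≤ n) (c : 𝕍) {T t : ℝ} (ht : t < T) (y : 𝕊) :
    HasMFDerivAt 𝓘(ℝ, ℝ) (𝓡 (n + 1)) (fun s ↦ shrinkingSphereFlowAt n c T s y) t
      (ContinuousLinearMap.smulRight (1 : ℝ →L[ℝ] ℝ)
        ((-(n / shrinkingSphereRadius n T t)) • (y : 𝕍))) :=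
  (((hasDerivAt_shrinkingSphereRadius hn ht).smul_const (y : 𝕍)).const_add c).hasFDerivAt.hasMFDerivAt

/-- **Homothetically shrinking round spheres about any centre `c` are a classical mean
curvature flow** (Euclidean metric, `n ≥ 1`), on every `[a, b]` with `b < T`.
[cite: Huisken1984, §1] -/
theorem isClassicalMCF_shrinkingSphereAt (hn : 1 ≤ n) (c : 𝕍) (T : ℝ) {a b : ℝ} (hb : b < T) :
    IsClassicalMCF (euclideanMetric 𝕍) (shrinkingSphereFlowAt n c T) (shrinkingSphereNormalAt n c T)
      a b where
  compactSpace := inferInstance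
  contMDiffOn := by
    refine ⟨Iio T, isOpen_Iio, fun t ht ↦ lt_of_le_of_lt ht.2 hb, ?_⟩
    have hRd : ContDiffOn ℝ ∞ (shrinkingSphereRadius n T) (Iio T) := fun t ht ↦
      (contDiffAt_shrinkingSphereRadius hn ht).contDiffWithinAt
    have hR : ContMDiffOn 𝓘(ℝ, ℝ) 𝓘(ℝ, ℝ) ∞ (shrinkingSphereRadius n T) (Iio T) := hRd.contMDiffOn
    have h0 : ContMDiffOn (𝓘(ℝ, ℝ).prod (𝓡 n)) (𝓡 (n + 1)) ∞ (fun _ : ℝ × 𝕊 ↦ c) (Iio T ×ˢ univ) :=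
      contMDiffOn_const
    have h1 : ContMDiffOn (𝓘(ℝ, ℝ).prod (𝓡 n)) 𝓘(ℝ, ℝ) ∞
        (fun p : ℝ × 𝕊 ↦ shrinkingSphereRadius n T p.1) (Iio T ×ˢ univ) :=
      hR.comp contMDiffOn_fst fun p hp ↦ hp.1
    have h2 : ContMDiffOn (𝓘(ℝ, ℝ).prod (𝓡 n)) (𝓡 (n + 1)) ∞
        (fun p : ℝ × 𝕊 ↦ ((p.2 : 𝕊) : 𝕍)) (Iio T ×ˢ univ) :=
      ((contMDiff_coe_sphere (n := n)).comp contMDiff_snd).contMDiffOn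
    exact h0.add (h1.smul h2)
  isSpacelikeImmersion t ht :=
    isSpacelikeImmersion_const_add_smul_coe_sphere c
      (shrinkingSphereRadius_pos hn (ht.2.trans_lt hb)).ne'
  injective t ht := injective_shrinkingSphereFlowAt hn c (ht.2.trans_lt hb)
  isUnitNormal t _ := isUnitNormal_const_add_smul_coe_sphere c _
  contMDiff_normal t ht := contMDiff_shrinkingSphereNormalAt hn c (ht.2.trans_lt hb)
  velocity_eq t ht y := by
    have htT : t < T := ht.2.trans_lt hb
    rw [(hasMFDerivAt_shrinkingSphereFlowAt hn c htT y).mfderiv,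
      meanCurvature_shrinkingSphereFlowAt hn c htT]
    change (ContinuousLinearMap.smulRight (1 : ℝ →L[ℝ] ℝ)
      ((-(n / shrinkingSphereRadius n T t)) • (y : 𝕍))) (1 : ℝ) =
        -((n : ℝ) / shrinkingSphereRadius n T t) • (y : 𝕍)
    simp

/-- **Round spheres about any centre are barriers for weak set flows**: a weak set flow in
`W ⊆ ℝⁿ⁺¹` on `I ⊇ [a, b]` (`b < T`) disjoint from `sphere c (R a)` at time `a` stays disjoint
from the shrinking spheres `sphere c (R t)`, `t ∈ [a, b]`, provided these lie in `W`.
[cite: HershkovitsWhite2019, Appendix Def. 19] [cite: White2000, §2] -/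
theorem IsWeakSetFlowIn.disjoint_shrinkingSphereAt (hn : 1 ≤ n) {W : Set 𝕍} {I : Set ℝ}
    {K : ℝ → Set 𝕍} (hK : IsWeakSetFlowIn (euclideanMetric 𝕍) W I K) (c : 𝕍) {T a b : ℝ}
    (hab : a ≤ b) (hb : b < T) (hI : Icc a b ⊆ I)
    (hW : ∀ t ∈ Icc a b, sphere c (shrinkingSphereRadius n T t) ⊆ W)
    (ha : Disjoint (sphere c (shrinkingSphereRadius n T a)) (K a)) {t : ℝ} (ht : t ∈ Icc a b) :
    Disjoint (sphere c (shrinkingSphereRadius n T t)) (K t) := by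
  have hr : ∀ s ∈ Icc a b, range (shrinkingSphereFlowAt n c T s) =
      sphere c (shrinkingSphereRadius n T s) :=
    fun s hs ↦ range_shrinkingSphereFlowAt hn c (hs.2.trans_lt hb)
  rw [← hr t ht]
  refine hK.avoidance hab hI (isClassicalMCF_shrinkingSphereAt hn c T hb) (fun s hs ↦ ?_) ?_ ht
  · rw [hr s hs]
    exact hW s hs
  · rw [hr a ⟨le_rfl, hab⟩]
    exact ha

/-- **Avoidance with a round sphere, radius form**: if `K a` misses `sphere c r₀` (`r₀ > 0`) then
`K (a + s)` misses `sphere c √(r₀² - 2ns)` for `0 ≤ s < r₀²/(2n)` (as long as `[a, a + s] ⊆ I`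
and the spheres lie in `W`). [cite: White2000, §2] -/
theorem IsWeakSetFlowIn.disjoint_sphere_sqrt (hn : 1 ≤ n) {W : Set 𝕍} {I : Set ℝ}
    {K : ℝ → Set 𝕍} (hK : IsWeakSetFlowIn (euclideanMetric 𝕍) W I K) (c : 𝕍) {a r₀ s : ℝ}
    (hr₀ : 0 < r₀) (hs : 0 ≤ s) (hsr : 2 * n * s < r₀ ^ 2) (hI : Icc a (a + s) ⊆ I)
    (hW : ∀ t ∈ Icc a (a + s), sphere c (Real.sqrt (r₀ ^ 2 - 2 * n * (t - a))) ⊆ W)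
    (ha : Disjoint (sphere c r₀) (K a)) :
    Disjoint (sphere c (Real.sqrt (r₀ ^ 2 - 2 * n * s))) (K (a + s)) := by
  have hn0 : (0 : ℝ) < n := by exact_mod_cast hn
  -- extinction time of the sphere of radius `r₀` at time `a`
  set T : ℝ := a + r₀ ^ 2 / (2 * n) with hT
  have hRad : ∀ t : ℝ, shrinkingSphereRadius n T t = Real.sqrt (r₀ ^ 2 - 2 * n * (t - a)) := by
    intro t
    unfold shrinkingSphereRadius
    congr 1
    rw [hT]
    field_simp
    ring
  have hb : a + s < T := by
    rw [hT, add_lt_add_iff_left, lt_div_iff₀ (by positivity)]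
    linarith
  have h := hK.disjoint_shrinkingSphereAt hn c (le_add_of_nonneg_right hs) hb hI
    (fun t ht ↦ by rw [hRad]; exact hW t ht) (by
      rw [hRad, sub_self, mul_zero, sub_zero, Real.sqrt_sq hr₀.le]
      exact ha) ⟨le_add_of_nonneg_right hs, le_rfl⟩
  rwa [hRad, add_sub_cancel_left] at h

end Centred

/-! ### Huisken's density of the shrinking sphere: the equality case of the monotonicity formula -/

section Density

variable {n : ℕ}

open scoped ENNReal Pointwise

/-- The time-`t` sphere is the dilate by `√(T - t)` of the self-shrinking sphere `𝕊ⁿ(√(2n))`.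
[cite: ColdingMinicozzi2012, p. 758] -/
theorem range_shrinkingSphereFlow_eq_smul (hn : 1 ≤ n) {T t : ℝ} (ht : t < T) :
    range (shrinkingSphereFlow n T t) =
      Real.sqrt (T - t) • sphere (0 : 𝕍) (Real.sqrt (2 * n)) := by
  have hc : 0 < Real.sqrt (T - t) := Real.sqrt_pos.2 (by linarith)
  rw [range_shrinkingSphereFlow hn ht, smul_sphere' hc.ne', smul_zero, Real.norm_of_nonneg hc.le,
    shrinkingSphereRadius, ← Real.sqrt_mul (by linarith : (0 : ℝ) ≤ T - t)]
  congr 1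
  ring_nf

/-- **Huisken's density of the shrinking sphere.** For every `t < T`,
`F_{0, T-t}(M_t) = Λ_n = λ(𝕊ⁿ)`: the Gaussian area of the time-`t` sphere, centred at the singular
point and at the scale of the remaining time, is the constant `λ(𝕊ⁿ)` — the equality case of
Huisken's monotonicity formula (the flow is self-similar about the spacetime point `(0, T)`), i.e.
the Gaussian density of the spherical singularity, `Θ = λ(𝕊ⁿ)` (the top generic stratum `𝔊⁰` of
Chodosh–Mantoulidis–Schulze 2025, §6.2). By the dilation invariance `F_{0,c²}(cA) = F_{0,1}(A)`
(`gaussianArea_smul`) and Stone's value `F_{0,1}(𝕊ⁿ(√(2n))) = Λ_n`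
(`gaussianArea_zero_one_shrinkingSphere`). [cite: ColdingMinicozzi2012, (1.8) and Lemma 7.10] -/
theorem gaussianArea_shrinkingSphereFlow (hn : 1 ≤ n) {T t : ℝ} (ht : t < T) :
    gaussianArea n (0 : 𝕍) (T - t) (range (shrinkingSphereFlow n T t)) =
      ENNReal.ofReal (sphereEntropy n) := by
  have hTt : 0 < T - t := by linarith
  have hc : Real.sqrt (T - t) ≠ 0 := (Real.sqrt_pos.2 hTt).ne'
  have h := gaussianArea_smul hc n (0 : 𝕍) one_pos (sphere (0 : 𝕍) (Real.sqrt (2 * n)))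
  rw [smul_zero, mul_one, Real.sq_sqrt hTt.le] at h
  rw [range_shrinkingSphereFlow_eq_smul hn ht, h,
    gaussianArea_zero_one_shrinkingSphere (finrank_euclideanSpace_fin (𝕜 := ℝ)) hn]

/-- **Every time slice of the shrinking sphere flow has entropy `λ(𝕊ⁿ) = Λ_n`** (dilation
invariance of the entropy and Stone's value). [cite: ColdingMinicozzi2012, Lemma 7.10] -/
theorem gaussianEntropy_shrinkingSphereFlow (hn : 1 ≤ n) {T t : ℝ} (ht : t < T) :
    gaussianEntropy n (range (shrinkingSphereFlow n T t)) = ENNReal.ofReal (sphereEntropy n) := by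
  have hc : Real.sqrt (T - t) ≠ 0 := (Real.sqrt_pos.2 (by linarith)).ne'
  rw [range_shrinkingSphereFlow_eq_smul hn ht, gaussianEntropy_smul hc,
    gaussianEntropy_shrinkingSphere (finrank_euclideanSpace_fin (𝕜 := ℝ)) hn]

/-- Hence along the flow Huisken's quantity is constant and equal to the entropy of the slice:
`F_{0,T-t}(M_t) = λ(M_t)` for all `t < T` (the entropy of each slice is attained at the centre
`0` and scale `T - t`). [cite: ColdingMinicozzi2012, Lemma 7.10] -/
theorem gaussianArea_shrinkingSphereFlow_eq_gaussianEntropy (hn : 1 ≤ n) {T t : ℝ} (ht : t < T) :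
    gaussianArea n (0 : 𝕍) (T - t) (range (shrinkingSphereFlow n T t)) =
      gaussianEntropy n (range (shrinkingSphereFlow n T t)) := by
  rw [gaussianArea_shrinkingSphereFlow hn ht, gaussianEntropy_shrinkingSphereFlow hn ht]

end Density

end Literature.Geometry.Riemannian

end
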